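import Mathlib
import Literature.Analysis.FluidPDE.NewtonPotentialHolder
import Literature.Analysis.FluidPDE.PressurePoisson
import Summits.NavierStokesRegularity.NavierStokesRegularity.Theorems.LandauTailLandauTailBlowupTypeIIFatou
import Summits.NavierStokesRegularity.NavierStokesRegularity.Theorems.LandauTailLandauTailBlowupWeakLimit
import Summits.NavierStokesRegularity.NavierStokesRegularity.Theorems.LandauTailLandauTailBlowupFluxIdentity

/-!
# Landau-tailed singularities: envelope, local integrability and the test fields `θ(t) φ(x)`

Preparatory helper file for the crux item `stmt-NavierStokesRegularity-1944` (`LandauTail.LandauTailBlowup`,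
line `registered`), serving the lead's main theorem of cycle c5 (`landauTail_scaledNorm_tendsto_top` in
`LandauTailLandauTailBlowupTypeII`: a Landau-tailed first singularity is Type II in every scaled Lebesgue
norm). Contents (all proved):

* `landauTail_profile_norm_le`, `landauTail_profile_measurable`,
  `landauTail_lintegral_profile_rpow_lt_top`, `landauTail_eLpNorm_profile_two_lt_top` — a
  `(−1)`-homogeneous profile continuous off the origin is enveloped by `K/|x|`, measurable, and in
  `L^q(B₁)` for `q < 3` (in particular in `L²(B₁)`);
* `landauTail_isSpaceTimeTestOn_smul`, `landauTail_veryWeak_smul_eq` — the product `θ(t) φ(x)` of a real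
  test function supported in `(−1,0)` and a smooth field supported in `B₁` is a space–time test field on
  the unit parabolic cylinder `Q₁(0,0)`, and on it the pressure-free very weak Navier–Stokes functional
  of a STEADY field `U` equals `(∫θ) ∫(⟪U,(U·∇)φ⟫ + ⟪U,Δφ⟫)` (the `∂ₜ` term integrates to zero);
* `landauTail_scaled_le_of_envelope` (registered support stub) — **a spatial Type-I envelope
  `|x| |u(t,x)| ≤ C` on `Q₁` bounds the CKN-scaled norms**: for `0 < q < 3` and `0 < r < 1`,
  `r^{q−5} ∫∫_{Q_r(0,0)} |u|^q ≤ ∫∫_{Q₁} (C/|y|)^q < ∞` — the envelope is invariant under the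
  Navier–Stokes scaling `u ↦ r u(r²t, r x)` (`landauTail_scaled_lintegral_eq_nsRescale`).

References: L. Caffarelli, R. Kohn, L. Nirenberg, CPAM 35 (1982), §2 (scaled quantities, cylinders
`Q_r`); G. Koch, N. Nadirashvili, G. Seregin, V. Šverák, Acta Math. 203 (2009), §4 (ii) (very weak
formulation); T.-P. Tsai, ARMA 143 (1998) (the envelope class `|u| ≤ C/|x|`).
-/

noncomputable section

open Filter Set Topology MeasureTheory Metric Function
open scoped ENNReal NNReal InnerProductSpace RealInnerProductSpace Laplacian ContDiff
open Literature.Analysis.FluidPDE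

-- the summit-side namespace repeats a component by design (D-0017)
set_option linter.dupNamespace false

namespace Summit.NavierStokesRegularity.NavierStokesRegularity.Theorems

/-! ### The profile: envelope, local integrability, measurability -/

/-- A `(−1)`-homogeneous field continuous off the origin is enveloped by `K/|x|`, `K = sup_{S²}|U|`.
[folklore] -/
theorem landauTail_profile_norm_le {U : EuclideanSpace ℝ (Fin 3) → EuclideanSpace ℝ (Fin 3)}
    (hU : ContinuousOn U {0}ᶜ) (hhom : ∀ c : ℝ, 0 < c → ∀ x, U (c • x) = c⁻¹ • U x) :
    ∃ K : ℝ, 0 ≤ K ∧ ∀ x, x ≠ 0 → ‖U x‖ ≤ K * ‖x‖ ^ (-1 : ℝ) := by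
  obtain ⟨M, hM⟩ := (isCompact_sphere (0 : EuclideanSpace ℝ (Fin 3)) 1).exists_bound_of_continuousOn
    (hU.mono fun x hx h0 => by simp [show x = 0 from h0] at hx)
  refine ⟨max M 0, le_max_right _ _, fun x hx => ?_⟩
  have hn : 0 < ‖x‖ := norm_pos_iff.2 hx
  have h1 : U x = ‖x‖⁻¹ • U (‖x‖⁻¹ • x) := by
    rw [hhom _ (inv_pos.2 hn), inv_inv, smul_smul, inv_mul_cancel₀ hn.ne', one_smul]
  have hs : ‖x‖⁻¹ • x ∈ sphere (0 : EuclideanSpace ℝ (Fin 3)) 1 := by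
    simp [norm_smul, inv_mul_cancel₀ hn.ne']
  rw [h1, norm_smul, norm_inv, norm_norm, Real.rpow_neg_one, mul_comm]
  exact mul_le_mul_of_nonneg_right ((hM _ hs).trans (le_max_left _ _)) (inv_nonneg.2 hn.le)

/-- A `(−1)`-homogeneous field continuous off the origin is (Borel) measurable. [folklore] -/
theorem landauTail_profile_measurable {U : EuclideanSpace ℝ (Fin 3) → EuclideanSpace ℝ (Fin 3)}
    (hU : ContinuousOn U {0}ᶜ) : Measurable U := by
  classical
  have h := hU.measurable_piecewise (continuousOn_singleton U 0 |>.mono (by simp))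
    isOpen_compl_singleton.measurableSet
  rwa [piecewise_same] at h

/-- **Local `L^q`-integrability of the profile below the critical exponent**: for a `(−1)`-homogeneous
field continuous off the origin and `0 < q < 3`, `∫_{B₁} |U|^q < ∞` (envelope `K/|x|` and
`|x|^{-q} ∈ L¹(B₁)` in `ℝ³`). [folklore] -/
theorem landauTail_lintegral_profile_rpow_lt_top {U : EuclideanSpace ℝ (Fin 3) → EuclideanSpace ℝ (Fin 3)}
    (hU : ContinuousOn U {0}ᶜ) (hhom : ∀ c : ℝ, 0 < c → ∀ x, U (c • x) = c⁻¹ • U x)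
    {q : ℝ} (hq0 : 0 < q) (hq3 : q < 3) :
    ∫⁻ x in ball (0 : EuclideanSpace ℝ (Fin 3)) 1, ‖U x‖ₑ ^ q < ⊤ := by
  obtain ⟨K, hK0, hK⟩ := landauTail_profile_norm_le hU hhom
  have hint : IntegrableOn (fun x : EuclideanSpace ℝ (Fin 3) => K ^ q * ‖x‖ ^ (-q)) (ball 0 1) volume :=
    (NewtonPotentialHolder.integrableOn_ball_norm_rpow_neg hq3 1).const_mul _
  have hae : ∀ᵐ x ∂(volume.restrict (ball (0 : EuclideanSpace ℝ (Fin 3)) 1)),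
      ‖U x‖ₑ ^ q ≤ ‖K ^ q * ‖x‖ ^ (-q)‖ₑ := by
    have h0 : ∀ᵐ x ∂(volume.restrict (ball (0 : EuclideanSpace ℝ (Fin 3)) 1)), x ≠ 0 := by
      rw [ae_restrict_iff' measurableSet_ball]
      filter_upwards [(compl_mem_ae_iff.2 (measure_singleton (0 : EuclideanSpace ℝ (Fin 3))))] with x hx _
      exact hx
    filter_upwards [h0] with x hx
    have hn : 0 < ‖x‖ := norm_pos_iff.2 hx
    have h1 : ‖U x‖ ≤ K * ‖x‖ ^ (-1 : ℝ) := hK x hx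
    have h2 : ‖U x‖ ^ q ≤ K ^ q * ‖x‖ ^ (-q) := by
      calc ‖U x‖ ^ q ≤ (K * ‖x‖ ^ (-1 : ℝ)) ^ q :=
            Real.rpow_le_rpow (norm_nonneg _) h1 hq0.le
        _ = K ^ q * ‖x‖ ^ (-q) := by
            rw [Real.mul_rpow hK0 (Real.rpow_nonneg hn.le _), ← Real.rpow_mul hn.le, neg_one_mul]
    have h3 : 0 ≤ K ^ q * ‖x‖ ^ (-q) := by positivity
    rw [Real.enorm_eq_ofReal h3, ← ofReal_norm, ENNReal.ofReal_rpow_of_nonneg (norm_nonneg _) hq0.le]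
    exact ENNReal.ofReal_le_ofReal h2
  exact lt_of_le_of_lt (lintegral_mono_ae hae) hint.2

/-- The profile is square integrable on the unit ball: `‖U‖_{L²(B₁)} < ∞`. [folklore] -/
theorem landauTail_eLpNorm_profile_two_lt_top {U : EuclideanSpace ℝ (Fin 3) → EuclideanSpace ℝ (Fin 3)}
    (hU : ContinuousOn U {0}ᶜ) (hhom : ∀ c : ℝ, 0 < c → ∀ x, U (c • x) = c⁻¹ • U x) :
    eLpNorm U 2 (volume.restrict (ball (0 : EuclideanSpace ℝ (Fin 3)) 1)) < ⊤ := by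
  rw [eLpNorm_eq_lintegral_rpow_enorm_toReal two_ne_zero ENNReal.ofNat_ne_top, ENNReal.toReal_ofNat]
  refine ENNReal.rpow_lt_top_of_nonneg (by norm_num) ?_
  exact (landauTail_lintegral_profile_rpow_lt_top hU hhom two_pos (by norm_num)).ne


/-! ### The space–time test field `θ(t) φ(x)` -/

/-- The product `(t, x) ↦ θ t • φ x` of a real test function supported in `(−1, 0)` and a smooth field
supported in the unit ball is a space–time test field on the unit parabolic cylinder `Q₁(0,0)`. [folklore] -/
theorem landauTail_isSpaceTimeTestOn_smul {θ : ℝ → ℝ} {φ : EuclideanSpace ℝ (Fin 3) → EuclideanSpace ℝ (Fin 3)}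
    (hθ : ContDiff ℝ ∞ θ) (hθK : IsCompact (tsupport θ)) (hθsupp : tsupport θ ⊆ Ioo (-1 : ℝ) 0)
    (hφ : ContDiff ℝ ∞ φ) (hφK : IsCompact (tsupport φ))
    (hφsupp : tsupport φ ⊆ ball (0 : EuclideanSpace ℝ (Fin 3)) 1)
    {ψ : ℝ → EuclideanSpace ℝ (Fin 3) → EuclideanSpace ℝ (Fin 3)} (hψ : ψ = fun t x => θ t • φ x) :
    IsSpaceTimeTestOn (parabolicCylinderOpens 1 ((0 : ℝ), (0 : EuclideanSpace ℝ (Fin 3)))) ψ := by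
  subst hψ
  set K : Set (ℝ × EuclideanSpace ℝ (Fin 3)) := tsupport θ ×ˢ tsupport φ with hK
  have hKc : IsCompact K := hθK.prod hφK
  have hzero : ∀ z : ℝ × EuclideanSpace ℝ (Fin 3), z ∉ K → θ z.1 • φ z.2 = 0 := by
    intro z hz
    rw [hK, mem_prod, not_and_or] at hz
    rcases hz with h | h
    · rw [image_eq_zero_of_notMem_tsupport h, zero_smul]
    · rw [image_eq_zero_of_notMem_tsupport h, smul_zero]
  have hsupp : tsupport (uncurry fun t x => θ t • φ x) ⊆ K :=
    closure_minimal (fun z hz => by_contra fun h => hz (hzero z h)) hKc.isClosed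
  refine ⟨(hθ.comp contDiff_fst).smul (hφ.comp contDiff_snd), HasCompactSupport.intro hKc hzero, ?_⟩
  intro z hz
  obtain ⟨h1, h2⟩ := hsupp hz
  have ht := hθsupp h1
  have hx := hφsupp h2
  rw [coe_parabolicCylinderOpens, mem_parabolicCylinder]
  refine ⟨⟨by norm_num; exact ht.1, ht.2⟩, by simpa using hx⟩

/-- **Evaluation of the very weak functional on `θ(t) φ(x)` for a steady field.** If `U` is steady,
with the envelope of a `(−1)`-homogeneous field continuous off the origin, then for the test field
`θ(t) φ(x)` (θ smooth, supported in `(−1,0)`; φ smooth with compact support in `B₁`) the very weak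
space–time functional equals `(∫ θ) · ∫ (⟪U,(U·∇)φ⟫ + ⟪U,Δφ⟫)` — the `∂ₜ`-term integrates to
`(∫ θ') ∫⟪U,φ⟫ = 0`. [folklore] -/
theorem landauTail_veryWeak_smul_eq {U : EuclideanSpace ℝ (Fin 3) → EuclideanSpace ℝ (Fin 3)}
    (hU : ContinuousOn U {0}ᶜ) (hhom : ∀ c : ℝ, 0 < c → ∀ x, U (c • x) = c⁻¹ • U x)
    {θ : ℝ → ℝ} (hθ : ContDiff ℝ ∞ θ) (hθsupp : tsupport θ ⊆ Ioo (-1 : ℝ) 0)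
    {φ : EuclideanSpace ℝ (Fin 3) → EuclideanSpace ℝ (Fin 3)} (hφ : ContDiff ℝ ∞ φ)
    (hφc : HasCompactSupport φ) (hφsupp : tsupport φ ⊆ ball (0 : EuclideanSpace ℝ (Fin 3)) 1)
    {ψ : ℝ → EuclideanSpace ℝ (Fin 3) → EuclideanSpace ℝ (Fin 3)} (hψ : ψ = fun t x => θ t • φ x) :
    ∫ t in Ioo (-1 : ℝ) 0, ∫ x, (⟪U x, timeDeriv ψ t x⟫ + ⟪U x, convect U (ψ t) x⟫ +
        1 * ⟪U x, Δ (ψ t) x⟫) =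
      (∫ t, θ t) * ∫ x, (⟪U x, convect U φ x⟫ + ⟪U x, Δ φ x⟫) := by
  subst hψ
  -- the two spatial integrals
  have hJ : Integrable fun x => ⟪U x, convect U φ x⟫ + ⟪U x, (Δ φ) x⟫ :=
    landauTail_integrable_veryWeak hU hhom (hφ.of_le (by norm_cast)) hφc
  obtain ⟨K, hK0, hK⟩ := landauTail_profile_norm_le hU hhom
  obtain ⟨Mφ, hMφ⟩ := hφc.exists_bound_of_continuous hφ.continuous
  have hUm : Measurable U := landauTail_profile_measurable hU
  have hI : Integrable fun x => ⟪U x, φ x⟫ := by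
    have hsupp : support (fun x => ⟪U x, φ x⟫) ⊆ ball 0 1 := by
      intro x hx
      by_contra h
      refine hx ?_
      show ⟪U x, φ x⟫ = 0
      rw [image_eq_zero_of_notMem_tsupport fun h' => h (hφsupp h'), inner_zero_right]
    rw [← integrableOn_iff_integrable_of_support_subset hsupp]
    refine Integrable.mono' ((NewtonPotentialHolder.integrableOn_ball_norm_rpow_neg (by norm_num : (1 : ℝ) < 3) 1).const_mul
      (K * Mφ)) (hUm.inner hφ.continuous.measurable).aestronglyMeasurable ?_
    rw [ae_restrict_iff' measurableSet_ball]
    filter_upwards [(compl_mem_ae_iff.2 (measure_singleton (0 : EuclideanSpace ℝ (Fin 3))))] with x hx _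
    calc ‖⟪U x, φ x⟫‖ ≤ ‖U x‖ * ‖φ x‖ := norm_inner_le_norm _ _
      _ ≤ (K * ‖x‖ ^ (-1 : ℝ)) * Mφ :=
          mul_le_mul (hK x hx) (hMφ x) (norm_nonneg _) (by positivity)
      _ = K * Mφ * ‖x‖ ^ (-(1 : ℝ)) := by ring
  -- the slice integrals
  have hslice : ∀ t, ∫ x, (⟪U x, timeDeriv (fun t x => θ t • φ x) t x⟫ +
      ⟪U x, convect U ((fun t x => θ t • φ x) t) x⟫ + 1 * ⟪U x, Δ ((fun t x => θ t • φ x) t) x⟫) =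
      deriv θ t * (∫ x, ⟪U x, φ x⟫) + θ t * ∫ x, (⟪U x, convect U φ x⟫ + ⟪U x, Δ φ x⟫) := by
    intro t
    have hpt : ∀ x, ⟪U x, timeDeriv (fun t x => θ t • φ x) t x⟫ +
        ⟪U x, convect U ((fun t x => θ t • φ x) t) x⟫ + 1 * ⟪U x, Δ ((fun t x => θ t • φ x) t) x⟫ =
        deriv θ t * ⟪U x, φ x⟫ + θ t * (⟪U x, convect U φ x⟫ + ⟪U x, Δ φ x⟫) := by
      intro x
      have hd : DifferentiableAt ℝ φ x := hφ.differentiable (by simp) x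
      have h2 : ContDiffAt ℝ 2 φ x := (hφ.of_le (by norm_cast)).contDiffAt
      have e1 : timeDeriv (fun t x => θ t • φ x) t x = deriv θ t • φ x := by
        rw [timeDeriv_apply]
        exact deriv_smul_const (hθ.differentiable (by simp) t) (φ x)
      have e2 : convect U ((fun t x => θ t • φ x) t) x = θ t • convect U φ x := by
        simp only [convect, fderiv_fun_const_smul hd, FunLike.coe_smul, Pi.smul_apply]
      have e3 : Δ ((fun t x => θ t • φ x) t) x = θ t • Δ φ x := InnerProductSpace.laplacian_smul (θ t) h2
      rw [e1, e2, e3, inner_smul_right, inner_smul_right, inner_smul_right, one_mul]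
      ring
    simp_rw [hpt]
    rw [integral_add ((hI.const_mul _)) (hJ.const_mul _), integral_const_mul, integral_const_mul]
  simp_rw [hslice]
  -- time integration: `∫ θ' = 0` and `∫_{(-1,0)} θ = ∫ θ`
  have hθc : HasCompactSupport θ :=
    HasCompactSupport.of_support_subset_isCompact (isCompact_Icc (a := -1) (b := 0))
      ((subset_tsupport θ).trans (hθsupp.trans Ioo_subset_Icc_self))
  have hθ' : ∀ t, HasDerivAt θ (deriv θ t) t := fun t => (hθ.differentiable (by simp) t).hasDerivAt
  have hθi : Integrable θ := hθ.continuous.integrable_of_hasCompactSupport hθc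
  have hθ'i : Integrable (deriv θ) :=
    (hθ.continuous_deriv (by simp)).integrable_of_hasCompactSupport hθc.deriv
  have hzero : ∀ t, t ∉ Ioo (-1 : ℝ) 0 → θ t = 0 := fun t ht =>
    image_eq_zero_of_notMem_tsupport fun h => ht (hθsupp h)
  have hzero' : ∀ t, t ∉ Ioo (-1 : ℝ) 0 → deriv θ t = 0 := by
    intro t ht
    have hopen : IsOpen (tsupport θ)ᶜ := (isClosed_tsupport θ).isOpen_compl
    have hmem : t ∈ (tsupport θ)ᶜ := fun h => ht (hθsupp h)
    have hnear : θ =ᶠ[𝓝 t] fun _ => 0 :=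
      Filter.eventually_of_mem (hopen.mem_nhds hmem) fun s hs => image_eq_zero_of_notMem_tsupport hs
    rw [hnear.deriv_eq, deriv_const]
  have e1 : ∫ t in Ioo (-1 : ℝ) 0, (deriv θ t * (∫ x, ⟪U x, φ x⟫) +
      θ t * ∫ x, (⟪U x, convect U φ x⟫ + ⟪U x, Δ φ x⟫)) =
      ∫ t, (deriv θ t * (∫ x, ⟪U x, φ x⟫) + θ t * ∫ x, (⟪U x, convect U φ x⟫ + ⟪U x, Δ φ x⟫)) := by
    refine setIntegral_eq_integral_of_forall_compl_eq_zero fun t ht => ?_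
    rw [hzero t ht, hzero' t ht, zero_mul, zero_mul, add_zero]
  have e2 : ∫ t, deriv θ t = 0 := integral_eq_zero_of_hasDerivAt_of_integrable hθ' hθ'i hθi
  rw [e1, integral_add (hθ'i.mul_const _) (hθi.mul_const _), integral_mul_const, integral_mul_const, e2,
    zero_mul, zero_add]


/-! ### Scale-invariant envelopes bound the scaled norms -/

/-- **An envelope bounds the scaled norms.** If `|x| |u(t,x)| ≤ C` on `Q₁ = (−1,0) × B₁`, then for
`0 < q < 3` and `0 < r < 1` the scaled norm `r^{q−5} ∫∫_{Q_r} |u|^q` is at most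
`∫∫_{Q₁} (C/|y|)^q < ∞` (the envelope is invariant under the Navier–Stokes scaling). [folklore] -/
theorem landauTail_scaled_le_of_envelope : ∀ (u : ℝ → EuclideanSpace ℝ (Fin 3) → EuclideanSpace ℝ (Fin 3)) (C q : ℝ), (∀ t ∈ Set.Ioo (-1 : ℝ) 0, ∀ x ∈ Metric.ball (0 : EuclideanSpace ℝ (Fin 3)) 1, ‖x‖ * ‖u t x‖ ≤ C) → 0 < q → q < 3 → ∃ K : ENNReal, K < ⊤ ∧ ∀ r ∈ Set.Ioo (0 : ℝ) 1, ENNReal.ofReal (r ^ (q - 5)) * ∫⁻ z in Literature.Analysis.FluidPDE.parabolicCylinder r ((0 : ℝ), (0 : EuclideanSpace ℝ (Fin 3))), ‖u z.1 z.2‖ₑ ^ q ≤ K := by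
  intro u C q hC hq0 hq3
  have hQ₁ : parabolicCylinder 1 ((0 : ℝ), (0 : EuclideanSpace ℝ (Fin 3))) =
      Ioo (-1 : ℝ) 0 ×ˢ ball (0 : EuclideanSpace ℝ (Fin 3)) 1 := by
    ext z
    simp only [mem_parabolicCylinder, mem_prod, mem_Ioo, mem_ball]
    norm_num
  have hSm : MeasurableSet (Ioo (-1 : ℝ) 0 ×ˢ ball (0 : EuclideanSpace ℝ (Fin 3)) 1) :=
    measurableSet_Ioo.prod measurableSet_ball
  have hC0 : 0 ≤ C := by
    have h := hC (-1/2) (by norm_num) 0 (mem_ball_self one_pos)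
    simpa using h
  set G : EuclideanSpace ℝ (Fin 3) → ℝ≥0∞ := fun y => ENNReal.ofReal (C ^ q * ‖y‖ ^ (-q)) with hG
  refine ⟨∫⁻ z in Ioo (-1 : ℝ) 0 ×ˢ ball (0 : EuclideanSpace ℝ (Fin 3)) 1, G z.2, ?_, ?_⟩
  · have hGm : Measurable G :=
      ENNReal.measurable_ofReal.comp (measurable_const.mul (measurable_norm.pow_const _))
    rw [Measure.volume_eq_prod, setLIntegral_prod (fun z : ℝ × EuclideanSpace ℝ (Fin 3) => G z.2)
      (hGm.comp measurable_snd).aemeasurable]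
    dsimp only
    rw [setLIntegral_const, Real.volume_Ioo]
    refine ENNReal.mul_lt_top ?_ ENNReal.ofReal_lt_top
    have hint : IntegrableOn (fun y : EuclideanSpace ℝ (Fin 3) => C ^ q * ‖y‖ ^ (-q)) (ball 0 1) volume :=
      (NewtonPotentialHolder.integrableOn_ball_norm_rpow_neg hq3 1).const_mul _
    refine lt_of_le_of_lt (lintegral_mono fun y => ?_) hint.2
    rw [hG]
    exact Real.ofReal_le_enorm _
  · rintro r ⟨hr0, hr1⟩
    rw [landauTail_scaled_lintegral_eq_nsRescale u q hq0 r hr0, hQ₁]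
    have hae0 : ∀ᵐ z ∂(volume : Measure (ℝ × EuclideanSpace ℝ (Fin 3))), z.2 ≠ 0 := by
      have e : {z : ℝ × EuclideanSpace ℝ (Fin 3) | z.2 = 0} = univ ×ˢ {0} := by
        ext z
        simp
      rw [ae_iff]
      simp only [not_not]
      rw [e, Measure.volume_eq_prod, Measure.prod_prod, measure_singleton, mul_zero]
    refine lintegral_mono_ae ?_
    rw [ae_restrict_iff' hSm]
    filter_upwards [hae0] with z hz2 hz
    obtain ⟨⟨hz1a, hz1b⟩, hzb⟩ := hz
    rw [mem_ball_zero_iff] at hzb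
    have hn : 0 < ‖z.2‖ := norm_pos_iff.2 hz2
    have ht : r ^ 2 * z.1 ∈ Ioo (-1 : ℝ) 0 := by
      have hr2 : r ^ 2 ≤ 1 := pow_le_one₀ hr0.le hr1.le
      refine ⟨?_, mul_neg_of_pos_of_neg (pow_pos hr0 2) hz1b⟩
      nlinarith [mul_nonneg (sub_nonneg.2 hr2) (neg_nonneg.2 hz1b.le)]
    have hx : r • z.2 ∈ ball (0 : EuclideanSpace ℝ (Fin 3)) 1 := by
      rw [mem_ball_zero_iff, norm_smul, Real.norm_of_nonneg hr0.le]
      nlinarith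
    have henv := hC _ ht _ hx
    rw [norm_smul, Real.norm_of_nonneg hr0.le] at henv
    have hval : ‖nsRescale r u z.1 z.2‖ ≤ C * ‖z.2‖ ^ (-q / q) := by
      rw [nsRescale_apply, norm_smul, Real.norm_of_nonneg hr0.le,
        show -q / q = (-1 : ℝ) by rw [neg_div, div_self hq0.ne'], Real.rpow_neg_one,
        le_mul_inv_iff₀ hn]
      nlinarith [norm_nonneg (u (r ^ 2 * z.1) (r • z.2))]
    have hval' : ‖nsRescale r u z.1 z.2‖ ^ q ≤ C ^ q * ‖z.2‖ ^ (-q) := by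
      calc ‖nsRescale r u z.1 z.2‖ ^ q ≤ (C * ‖z.2‖ ^ (-q / q)) ^ q :=
            Real.rpow_le_rpow (norm_nonneg _) hval hq0.le
        _ = C ^ q * ‖z.2‖ ^ (-q) := by
            rw [Real.mul_rpow hC0 (Real.rpow_nonneg hn.le _), ← Real.rpow_mul hn.le,
              div_mul_cancel₀ _ hq0.ne']
    rw [hG, ← ofReal_norm, ENNReal.ofReal_rpow_of_nonneg (norm_nonneg _) hq0.le]
    exact ENNReal.ofReal_le_ofReal hval'

end Summit.NavierStokesRegularity.NavierStokesRegularity.Theorems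

end
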